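import Mathlib
import HarnessLib
import Summits.ValiantsHypothesis.ValiantsHypothesis.Theses.MonotoneRestoration
import Literature.ModelTheory.FiniteModelTheory.CkEquiv
import Literature.ModelTheory.FiniteModelTheory.CountingWidth
import Literature.Computability.AlgebraicComplexity.ArithCircuit

/-!
# ValiantsHypothesis / MonotoneRestoration — `MonotoneRestorationQP`, line `Sketch`, stub F2

Support file for crux item `stmt-ValiantsHypothesis-15886`
(`Summit.ValiantsHypothesis.ValiantsHypothesis.Theses.MonotoneRestoration.MonotoneRestorationQP`),
line `Sketch`, stub `stub_crux_implies_fooling` (crux ⇒ fooling, by diagonalisation).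

The crux `MonotoneRestorationQP` speaks about FAMILIES of nonnegative matrix-symmetric
polynomials and its output exponent depends on the family; the fooling statement is about single
polynomials with an exponent `c'` depending only on `c`. Granted the per-`n` fooling of
quasi-polynomial square-symmetric circuits (hypothesis `hF1`), the passage is a compactness /
diagonal argument: if for every `c'` there were a bad instance `(n_{c'}, f_{c'}, X_{c'}, Y_{c'})`,
then `n_{c'} > c'` for `c' ≥ 1` (with `k ≥ n` pebbles `≡^{C^k}` is isomorphism, and a
matrix-symmetric polynomial does not separate isomorphic graphs), so the levels
`e₀ = 1, e_{j+1} = n_{e_j}` increase strictly; the bad instances at the sizes `n_{e_j}` (pairwise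
distinct) assemble into ONE family of polynomial degree and monotone complexity, the crux gives it
quasi-polynomial symmetric circuits with some exponent `c₁`, `hF1` fools them at level
`(log₂ m + c₂)^{c₂}`, and at `j = c₂` (`e_j ≥ j`) the bad pair is `≡^{C^k}` for
`k = (log₂ m + e_j)^{e_j} ≥ (log₂ m + c₂)^{c₂}` — a contradiction.
-/

-- `Summit.ValiantsHypothesis.ValiantsHypothesis.…` is the tree's mandated single-conjunct layout
-- (Sub = Summit), so the duplicated namespace component is intended.
set_option linter.dupNamespace false

namespace Summit.ValiantsHypothesis.ValiantsHypothesis.Theorems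

open Summit.ValiantsHypothesis.ValiantsHypothesis.Theses.MonotoneRestoration
open Literature.Computability.AlgebraicComplexity
open Literature.ModelTheory.FiniteModelTheory

/-- A polynomial in the matrix variables `x_{ij}` that is invariant under the diagonal renaming
along a map `γ` carrying the adjacency of `X` exactly onto the adjacency of `Y` takes the same
value at the adjacency matrices of `X` and of `Y`. [folklore] -/
theorem cruxImpliesFooling_eval_adj_eq {V R : Type*} [CommSemiring R] {X Y : SimpleGraph V}
    (γ : V → V) (hγ : ∀ a b, Y.Adj (γ a) (γ b) ↔ X.Adj a b) (p : MvPolynomial (V × V) R)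
    (hp : MvPolynomial.rename (fun ij : V × V => (γ ij.1, γ ij.2)) p = p) :
    MvPolynomial.eval (Set.indicator {ij : V × V | X.Adj ij.1 ij.2} 1) p =
      MvPolynomial.eval (Set.indicator {ij : V × V | Y.Adj ij.1 ij.2} 1) p := by
  classical
  have hg : (Set.indicator {ij : V × V | Y.Adj ij.1 ij.2} (1 : V × V → R)) ∘
      (fun ij : V × V => (γ ij.1, γ ij.2)) = Set.indicator {ij : V × V | X.Adj ij.1 ij.2} 1 := by
    funext ij
    simp only [Function.comp_apply, Set.indicator_apply, Set.mem_setOf_eq, hγ, Pi.one_apply]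
  rw [← hg, ← MvPolynomial.eval_rename, hp]

/-- Monotonicity of `t ↦ (a + t) ^ t` on positive integers: `(a + s) ^ s ≤ (a + t) ^ t` for
`s ≤ t`, `1 ≤ t`. [folklore] -/
theorem cruxImpliesFooling_pow_le (a : ℕ) {s t : ℕ} (hst : s ≤ t) (ht : 1 ≤ t) :
    (a + s) ^ s ≤ (a + t) ^ t :=
  (Nat.pow_le_pow_left (Nat.add_le_add_left hst a) s).trans
    (Nat.pow_le_pow_right (Nat.lt_of_lt_of_le ht (Nat.le_add_left t a)) hst)

/-- At least one pebble pair per vertex decides isomorphism, and a matrix-symmetric polynomial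
over `ℝ≥0` does not separate isomorphic graphs after complexification: if `n ≤ k`, `1 ≤ k` and
`X ≡^{C^k} Y` on `Fin n`, then `map f` takes equal values at the adjacency matrices of `X` and
`Y`. [folklore] -/
theorem cruxImpliesFooling_eval_eq_of_card_le {n k : ℕ}
    (f : MvPolynomial (Fin n × Fin n) NNReal)
    (hsym : ∀ σ τ : Equiv.Perm (Fin n),
      MvPolynomial.rename (fun p : Fin n × Fin n => (σ p.1, τ p.2)) f = f)
    {X Y : SimpleGraph (Fin n)} (hXY : CkEquiv k X Y) (hk : 1 ≤ k) (hnk : n ≤ k) :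
    MvPolynomial.eval (Set.indicator {ij : Fin n × Fin n | X.Adj ij.1 ij.2} 1)
        (MvPolynomial.map (Complex.ofRealHom.comp NNReal.toRealHom) f) =
      MvPolynomial.eval (Set.indicator {ij : Fin n × Fin n | Y.Adj ij.1 ij.2} 1)
        (MvPolynomial.map (Complex.ofRealHom.comp NNReal.toRealHom) f) := by
  obtain ⟨γ⟩ := hXY.nonempty_iso hk ((Fintype.card_fin n).trans_le hnk)
  refine cruxImpliesFooling_eval_adj_eq γ.toEquiv (fun a b => γ.map_rel_iff') _ ?_
  rw [← MvPolynomial.map_rename, hsym]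

/-- **Stub F2** (crux ⇒ fooling, line `Sketch` of `MonotoneRestorationQP`). Granted the per-`n`
fooling of quasi-polynomial square-symmetric circuits by `≡^{C^k}` at polylogarithmic `k`
(hypothesis `hF1`, uniform in the size exponent), the crux `MonotoneRestorationQP` implies that
every nonnegative matrix-symmetric polynomial of degree and monotone complexity `≤ (n + 2) ^ c`
takes equal values (after complexification) at the adjacency matrices of any two
`≡^{C^k}`-equivalent graphs, `k = (log₂ n + c') ^ c'` with `c'` depending on `c` only — by the
diagonal argument described in the module docstring. [folklore] -/
theorem stub_crux_implies_fooling
    (hF1 : ∀ c : ℕ, ∃ c' : ℕ, ∀ (n : ℕ) (p : MvPolynomial (Fin n × Fin n) ℂ),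
      (∃ (G : Type) (_ : Fintype G) (C : LabelledArithCircuit ℂ (Fin n × Fin n) Unit G),
        C.IsSymmetric (Equiv.Perm (Fin n)) ∧ C.eval (C.output ()) = p ∧
        Fintype.card G ≤ 2 ^ ((Nat.log 2 n + c) ^ c)) →
      ∀ X Y : SimpleGraph (Fin n), CkEquiv ((Nat.log 2 n + c') ^ c') X Y →
        MvPolynomial.eval (Set.indicator {ij : Fin n × Fin n | X.Adj ij.1 ij.2} 1) p =
          MvPolynomial.eval (Set.indicator {ij : Fin n × Fin n | Y.Adj ij.1 ij.2} 1) p) :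
    MonotoneRestorationQP →
    ∀ c : ℕ, ∃ c' : ℕ, ∀ (n : ℕ) (f : MvPolynomial (Fin n × Fin n) NNReal),
      (∀ σ τ : Equiv.Perm (Fin n),
        MvPolynomial.rename (fun p : Fin n × Fin n => (σ p.1, τ p.2)) f = f) →
      f.totalDegree ≤ (n + 2) ^ c → complexity (k := NNReal) f ≤ (n + 2) ^ c →
      ∀ X Y : SimpleGraph (Fin n), CkEquiv ((Nat.log 2 n + c') ^ c') X Y →
        MvPolynomial.eval (Set.indicator {ij : Fin n × Fin n | X.Adj ij.1 ij.2} 1)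
            (MvPolynomial.map (Complex.ofRealHom.comp NNReal.toRealHom) f) =
          MvPolynomial.eval (Set.indicator {ij : Fin n × Fin n | Y.Adj ij.1 ij.2} 1)
            (MvPolynomial.map (Complex.ofRealHom.comp NNReal.toRealHom) f) := by
  intro hcrux c
  by_contra hcon
  push Not at hcon
  -- a bad instance `(n c', f, X, Y)` for every candidate exponent `c'`
  choose n hn using hcon
  -- (i) a bad instance at level `c' ≥ 1` has more than `c'` vertices
  have hpos : ∀ c', 1 ≤ c' → c' < n c' := by
    intro c' hc'
    obtain ⟨fm, hsym, -, -, X, Y, hXY, hne⟩ := hn c'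
    by_contra! hle
    have hk : c' ≤ (Nat.log 2 (n c') + c') ^ c' :=
      calc c' = c' ^ 1 := (pow_one _).symm
        _ ≤ c' ^ c' := Nat.pow_le_pow_right hc' hc'
        _ ≤ (Nat.log 2 (n c') + c') ^ c' := Nat.pow_le_pow_left (Nat.le_add_left _ _) _
    exact hne (cruxImpliesFooling_eval_eq_of_card_le fm hsym hXY (hc'.trans hk) (hle.trans hk))
  -- (ii) strictly increasing levels `e 0 = 1`, `e (j + 1) = n (e j)`
  obtain ⟨e, he0, hes⟩ : ∃ e : ℕ → ℕ, e 0 = 1 ∧ ∀ j, e (j + 1) = n (e j) :=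
    ⟨fun j => n^[j] 1, rfl, fun j => Function.iterate_succ_apply' n j 1⟩
  have he1 : ∀ j, 1 ≤ e j := by
    intro j
    induction j with
    | zero => rw [he0]
    | succ j ih => rw [hes]; exact ih.trans (hpos _ ih).le
  have he : StrictMono e := strictMono_nat_of_lt_succ fun j => by rw [hes]; exact hpos _ (he1 j)
  have hinj : ∀ {a b : ℕ}, n (e a) = n (e b) → a = b := by
    intro a b hab
    have h := he.injective (show e (a + 1) = e (b + 1) by rw [hes, hes]; exact hab)
    omega
  -- (iii) the bad instances at the (pairwise distinct) sizes `n (e j)` form one family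
  have key : ∀ m : ℕ, ∃ fm : MvPolynomial (Fin m × Fin m) NNReal,
      (∀ σ τ : Equiv.Perm (Fin m),
        MvPolynomial.rename (fun p : Fin m × Fin m => (σ p.1, τ p.2)) fm = fm) ∧
      fm.totalDegree ≤ (m + 2) ^ c ∧ complexity (k := NNReal) fm ≤ (m + 2) ^ c ∧
      ∀ j, n (e j) = m → ∃ X Y : SimpleGraph (Fin m),
        CkEquiv ((Nat.log 2 m + e j) ^ (e j)) X Y ∧
        MvPolynomial.eval (Set.indicator {ij : Fin m × Fin m | X.Adj ij.1 ij.2} 1)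
            (MvPolynomial.map (Complex.ofRealHom.comp NNReal.toRealHom) fm) ≠
          MvPolynomial.eval (Set.indicator {ij : Fin m × Fin m | Y.Adj ij.1 ij.2} 1)
            (MvPolynomial.map (Complex.ofRealHom.comp NNReal.toRealHom) fm) := by
    intro m
    by_cases hm : ∃ j, n (e j) = m
    · obtain ⟨j, rfl⟩ := hm
      obtain ⟨fm, hsym, hdeg, hcx, X, Y, hXY, hne⟩ := hn (e j)
      refine ⟨fm, hsym, hdeg, hcx, fun j' hj' => ?_⟩
      obtain rfl : j' = j := hinj hj'
      exact ⟨X, Y, hXY, hne⟩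
    · refine ⟨0, fun σ τ => map_zero _, by simp, ?_, fun j hj => (hm ⟨j, hj⟩).elim⟩
      have h0 := complexity_C_holds (k := NNReal) (σ := Fin m × Fin m) 0
      rw [MvPolynomial.C_0] at h0
      rw [h0]
      exact Nat.zero_le _
  choose g hgsym hgdeg hgcx hgbad using key
  -- (iv) the crux restores the family symmetrically, `hF1` fools the symmetric circuits
  obtain ⟨c₁, hc₁⟩ := hcrux g (fun m σ τ => hgsym m σ τ) ⟨c, fun m => ⟨hgdeg m, hgcx m⟩⟩
  obtain ⟨c₂, hc₂⟩ := hF1 c₁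
  -- (v) diagonalise at `j = c₂`
  obtain ⟨X, Y, hXY, hne⟩ := hgbad (n (e c₂)) c₂ rfl
  exact hne (hc₂ (n (e c₂)) _ (hc₁ (n (e c₂))) X Y
    (hXY.mono (cruxImpliesFooling_pow_le _ he.le_apply (he1 c₂))))

end Summit.ValiantsHypothesis.ValiantsHypothesis.Theorems
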